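import Literature.Probability.Percolation.DKTLemma6Geometry
import HarnessLib

/-!
# DKT 2020, Lemma 6 — closed pivotality, translates, and the second-moment bound

Topic `Literature/Probability/Percolation`. The probabilistic skeleton of the proof of Lemma 6 of
Duminil-Copin–Kozma–Tassion 2020 (§4) for bond percolation on `ℤ^d`:

* `real_isPivotal_eq` — "pivotality is independent of the status of the edge, hence the probability
  of being closed pivotal is `1 − p` times the probability of being pivotal":
  `(1−p) P_p(e pivotal for A) = P_p(e closed and pivotal)`;
* `real_closedPivotal_translate` — translation invariance of the closed-pivotal probability for
  the translated systems `(armEventAt (v) m n, e + v)`;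
* `sq_sum_real_le_sum_sum_real_inter` — `(Σ_k P(B_k))² ≤ Σ_{k,l} P(B_k ∩ B_l)`
  (`(E M)² ≤ E[M²]`, DKT eq. (32));
* `closedPivotal_le_sqrt` — the conclusion of the sliding argument: if the `I` translates
  `B_0, …, B_{I−1}` have equal probability `π'` and pairwise intersections of probability `≤ Q`,
  then `π' ≤ √(1/I + Q)` (DKT (32)–(34)).

## References

* H. Duminil-Copin, G. Kozma, V. Tassion, arXiv:1902.03207, Lemma 6 (proof, (32)–(34))
  [DuminilcopinKozmaTassion2020].
-/

noncomputable section

namespace Literature.Probability.Percolation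

namespace DKT20

open _root_.MeasureTheory LatticeModels Finset GM
open scoped Classical

variable {d : ℕ}

/-! ## Closed pivotality versus pivotality -/

/-- **`(1 − p) P_p(e pivotal) = P_p(e closed and pivotal)`** for an event determined by a finite
edge set: pivotality of `e` is determined by the other edges. [cite: DuminilcopinKozmaTassion2020, Prop 5 (proof: "pivotality is independent of the status of the edge")] -/
theorem real_closedPivotal_eq {V : Type*} [Countable V] (G : SimpleGraph V) {F : Finset (Sym2 V)}
    {A : Set (BondConfig V)} (hAF : DeterminedBy A (↑F : Set (Sym2 V))) (p : unitInterval) {e : Sym2 V} (he : e ∈ G.edgeSet) :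
    (bondPercolation G p).real {ω | e ∉ ω ∧ IsPivotal A e ω} = (1 - p) * (bondPercolation G p).real {ω | IsPivotal A e ω} := by
  have hdet : DeterminedBy {ω : BondConfig V | IsPivotal A e ω} ({e}ᶜ : Set (Sym2 V)) :=
    (Russo.determinedBy_isPivotal hAF e).mono (by intro f hf; simp only [Finset.coe_erase, Set.mem_sdiff, Set.mem_singleton_iff] at hf; exact hf.2)
  have hclosed : DeterminedBy {ω : BondConfig V | e ∉ ω} ({e} : Set (Sym2 V)) := by
    rw [determinedBy_iff]; intro ω ω' h
    have := Set.ext_iff.1 h e; simp at this; simp [this]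
  have hmeas : MeasurableSet {ω : BondConfig V | IsPivotal A e ω} := (Russo.determinedBy_isPivotal hAF e).measurableSet_of_finset
  have hset : {ω : BondConfig V | e ∉ ω ∧ IsPivotal A e ω} = {ω | e ∉ ω} ∩ {ω | IsPivotal A e ω} := rfl
  rw [hset, bondPercolation_real_inter_of_disjoint G p (disjoint_compl_right (a := ({e} : Set (Sym2 V)))) hclosed hdet
    (measurableSet_mem e).compl hmeas, DCT16.real_notMem G p he]

/-- Measurability of the closed-pivotal event. [folklore] -/
theorem measurableSet_closedPivotal {V : Type*} {F : Finset (Sym2 V)} {A : Set (BondConfig V)}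
    (hAF : DeterminedBy A (↑F : Set (Sym2 V))) (e : Sym2 V) :
    MeasurableSet {ω : BondConfig V | e ∉ ω ∧ IsPivotal A e ω} :=
  (measurableSet_mem e).compl.inter (Russo.determinedBy_isPivotal hAF e).measurableSet_of_finset

/-! ## Translates -/

/-- Relabelling transports pivotality: `e` is pivotal for `R⁻¹'A` at `ω` iff `e2 e` is pivotal for
`A` at `R ω` (`R = relabel e2`). [folklore] -/
theorem isPivotal_preimage_relabel_iff {V W : Type*} (e2 : Sym2 V ≃ Sym2 W) (A : Set (BondConfig W)) (e : Sym2 V) (ω : BondConfig V) :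
    IsPivotal (BondConfig.relabel e2 ⁻¹' A) e ω ↔ IsPivotal A (e2 e) (BondConfig.relabel e2 ω) := by
  unfold IsPivotal
  simp only [Set.mem_preimage, BondConfig.relabel_apply, Set.image_insert_eq, Set.image_sdiff e2.injective, Set.image_singleton]

/-- **The translated arm event is the pull-back of the arm event.** [folklore] -/
theorem armEventAt_eq_preimage (v : Site d) (m n : ℕ) :
    armEventAt v m n = BondConfig.relabel (sym2Equiv (Site.shift (-v))) ⁻¹' armEvent (d := d) m n := by
  ext ω
  simp only [armEventAt, armEvent, Set.mem_preimage, Set.mem_setOf_eq]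
  constructor
  · rintro ⟨x, hx, hr⟩
    refine ⟨x - v, ?_, (AKN.reaches_shift_iff v n ω x).2 hr⟩
    rw [mem_ball] at hx; rw [mem_box]; simpa [Pi.sub_apply] using hx
  · rintro ⟨y, hy, hr⟩
    refine ⟨y + v, ?_, ?_⟩
    · rw [mem_box] at hy; rw [mem_ball]; simpa using hy
    · have := (AKN.reaches_shift_iff v n ω (y + v)).1 (by simpa using hr)
      exact this

/-- **Translation invariance of the closed-pivotal probability**: for the system translated by
`v` (`armEventAt v m n`, edge `{x + v, y + v}`), the probability equals that at the origin.
[cite: DuminilcopinKozmaTassion2020, Lemma 6 (proof: "translation invariance")] -/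
theorem real_closedPivotal_translate (p : unitInterval) (v : Site d) (m n : ℕ) (x y : Site d) :
    (bondPercolation (zdGraph d) p).real {ω | s(x + v, y + v) ∉ ω ∧ IsPivotal (armEventAt v m n) s(x + v, y + v) ω} =
      (bondPercolation (zdGraph d) p).real {ω | s(x, y) ∉ ω ∧ IsPivotal (armEvent (d := d) m n) s(x, y) ω} := by
  have hpre : {ω : BondConfig (Site d) | s(x + v, y + v) ∉ ω ∧ IsPivotal (armEventAt v m n) s(x + v, y + v) ω} =
      BondConfig.relabel (sym2Equiv (Site.shift (-v))) ⁻¹' {ω | s(x, y) ∉ ω ∧ IsPivotal (armEvent (d := d) m n) s(x, y) ω} := by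
    ext ω
    simp only [Set.mem_setOf_eq, Set.mem_preimage]
    rw [armEventAt_eq_preimage, isPivotal_preimage_relabel_iff]
    have hedge : (sym2Equiv (Site.shift (-v))) s(x + v, y + v) = s(x, y) := by
      rw [sym2Equiv_mk]; simp [Site.shift_apply]
    rw [hedge]
    have hmem : s(x + v, y + v) ∈ ω ↔ s(x, y) ∈ BondConfig.relabel (sym2Equiv (Site.shift (-v))) ω := by
      rw [← mk_mem_relabel_iff (Site.shift (-v)) ω (x + v) (y + v)]
      simp [Site.shift_apply]
    rw [hmem]
  rw [hpre, bondPercolation_real_preimage_shift]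

/-! ## The second-moment bound -/

/-- **`(Σ_k P(B_k))² ≤ Σ_k Σ_l P(B_k ∩ B_l)`** (`(E M)² ≤ E[M²]` for `M = Σ_k 1_{B_k}`, DKT (32)),
for finitely many measurable events of a probability measure. [cite: DuminilcopinKozmaTassion2020, Lemma 6 (proof, (32))] -/
theorem sq_sum_real_le_sum_sum_real_inter {Ω ι : Type*} [MeasurableSpace Ω] (μ : Measure Ω) [IsProbabilityMeasure μ]
    (s : Finset ι) {B : ι → Set Ω} (hB : ∀ k ∈ s, MeasurableSet (B k)) :
    (∑ k ∈ s, μ.real (B k)) ^ 2 ≤ ∑ k ∈ s, ∑ l ∈ s, μ.real (B k ∩ B l) := by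
  -- `S = Σ_k 1_{B_k}`
  set S : Ω → ℝ := fun ω => ∑ k ∈ s, (B k).indicator (fun _ => (1 : ℝ)) ω with hS
  have hind : ∀ k ∈ s, Integrable (fun ω => (B k).indicator (fun _ => (1 : ℝ)) ω) μ :=
    fun k hk => (integrable_const (1 : ℝ)).indicator (hB k hk)
  have hSi : Integrable S μ := integrable_finsetSum _ hind
  have hSm : AEStronglyMeasurable S μ := hSi.aestronglyMeasurable
  have hSbdd : ∀ ω, |S ω| ≤ s.card := by
    intro ω
    have h0 : 0 ≤ S ω := Finset.sum_nonneg fun k _ => Set.indicator_nonneg (fun _ _ => zero_le_one) _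
    rw [abs_of_nonneg h0]
    calc S ω ≤ ∑ _k ∈ s, (1 : ℝ) := Finset.sum_le_sum fun k _ => Set.indicator_le_self' (fun _ _ => zero_le_one) ω |>.trans (le_refl _)
      _ = s.card := by simp
  have hS2i : Integrable (fun ω => S ω ^ 2) μ := by
    refine Integrable.mono' (integrable_const ((s.card : ℝ) ^ 2)) (hSm.pow 2) (ae_of_all _ fun ω => ?_)
    rw [Real.norm_eq_abs, abs_pow]
    exact pow_le_pow_left₀ (abs_nonneg _) (hSbdd ω) 2
  -- `∫ S = Σ P(B_k)` and `∫ S² = Σ Σ P(B_k ∩ B_l)`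
  have hES : ∫ ω, S ω ∂μ = ∑ k ∈ s, μ.real (B k) := by
    rw [integral_finsetSum _ hind]
    exact Finset.sum_congr rfl fun k hk => by rw [integral_indicator_const _ (hB k hk), smul_eq_mul, mul_one]
  have hES2 : ∫ ω, S ω ^ 2 ∂μ = ∑ k ∈ s, ∑ l ∈ s, μ.real (B k ∩ B l) := by
    have hsq : ∀ ω, S ω ^ 2 = ∑ k ∈ s, ∑ l ∈ s, (B k ∩ B l).indicator (fun _ => (1 : ℝ)) ω := by
      intro ω
      rw [sq, hS, Finset.sum_mul_sum]
      refine Finset.sum_congr rfl fun k _ => Finset.sum_congr rfl fun l _ => ?_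
      by_cases hk : ω ∈ B k <;> by_cases hl : ω ∈ B l <;> simp [Set.indicator, hk, hl]
    simp_rw [hsq]
    rw [integral_finsetSum _ fun k hk => integrable_finsetSum _ fun l hl => (integrable_const (1 : ℝ)).indicator ((hB k hk).inter (hB l hl))]
    refine Finset.sum_congr rfl fun k hk => ?_
    rw [integral_finsetSum _ fun l hl => (integrable_const (1 : ℝ)).indicator ((hB k hk).inter (hB l hl))]
    exact Finset.sum_congr rfl fun l hl => by rw [integral_indicator_const _ ((hB k hk).inter (hB l hl)), smul_eq_mul, mul_one]
  -- `0 ≤ ∫ (S - c)² = ∫ S² - c²`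
  set c := ∫ ω, S ω ∂μ with hc
  have hvar : 0 ≤ ∫ ω, (S ω - c) ^ 2 ∂μ := integral_nonneg fun ω => sq_nonneg _
  have hexp : ∫ ω, (S ω - c) ^ 2 ∂μ = (∫ ω, S ω ^ 2 ∂μ) - 2 * c * (∫ ω, S ω ∂μ) + c ^ 2 := by
    have h1 : ∀ ω, (S ω - c) ^ 2 = S ω ^ 2 - 2 * c * S ω + c ^ 2 := fun ω => by ring
    simp_rw [h1]
    have i2 : Integrable (fun ω => 2 * c * S ω) μ := hSi.const_mul (2 * c)
    have i1 : Integrable (fun ω => S ω ^ 2 - 2 * c * S ω) μ := hS2i.sub i2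
    rw [integral_add i1 (integrable_const _), integral_sub hS2i i2,
      integral_const_mul, integral_const, smul_eq_mul, probReal_univ, one_mul]
  rw [← hc] at hexp
  rw [← hES, ← hES2]
  nlinarith [hvar, hexp]

/-- **The sliding second-moment bound** (DKT (32)–(34)): events `B_0, …, B_{I−1}` (`I ≥ 1`) of equal
probability `π'` whose pairwise intersections (`k ≠ l`) have probability at most `Q ≥ 0` satisfy
`π' ≤ √(1/I + Q)`. [cite: DuminilcopinKozmaTassion2020, Lemma 6 (proof, (32)-(34))] -/
theorem closedPivotal_le_sqrt {Ω : Type*} [MeasurableSpace Ω] (μ : Measure Ω) [IsProbabilityMeasure μ]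
    {I : ℕ} (hI : 1 ≤ I) {B : ℕ → Set Ω} (hB : ∀ k < I, MeasurableSet (B k)) {π' Q : ℝ} (hQ : 0 ≤ Q)
    (hπ : ∀ k < I, μ.real (B k) = π') (hpair : ∀ k < I, ∀ l < I, k ≠ l → μ.real (B k ∩ B l) ≤ Q) :
    π' ≤ Real.sqrt (1 / I + Q) := by
  have hI0 : (0 : ℝ) < I := by exact_mod_cast hI
  have hπ0 : 0 ≤ π' := by rw [← hπ 0 hI]; exact measureReal_nonneg
  have hπ1 : π' ≤ 1 := by rw [← hπ 0 hI]; exact measureReal_le_one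
  have hsq := sq_sum_real_le_sum_sum_real_inter μ (Finset.range I) (fun k hk => hB k (Finset.mem_range.1 hk))
  have hsum : ∑ k ∈ Finset.range I, μ.real (B k) = I * π' := by
    rw [Finset.sum_congr rfl fun k hk => hπ k (Finset.mem_range.1 hk), Finset.sum_const, Finset.card_range, nsmul_eq_mul]
  have hdouble : ∑ k ∈ Finset.range I, ∑ l ∈ Finset.range I, μ.real (B k ∩ B l) ≤ I * π' + I * I * Q := by
    have hrow : ∀ k ∈ Finset.range I, ∑ l ∈ Finset.range I, μ.real (B k ∩ B l) ≤ π' + I * Q := by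
      intro k hk
      have hkI := Finset.mem_range.1 hk
      rw [← Finset.sum_erase_add _ _ hk]
      have hdiag : μ.real (B k ∩ B k) = π' := by rw [Set.inter_self, hπ k hkI]
      have hoff : ∑ l ∈ (Finset.range I).erase k, μ.real (B k ∩ B l) ≤ I * Q := by
        calc ∑ l ∈ (Finset.range I).erase k, μ.real (B k ∩ B l) ≤ ∑ _l ∈ (Finset.range I).erase k, Q :=
              Finset.sum_le_sum fun l hl => hpair k hkI l (Finset.mem_range.1 (Finset.mem_of_mem_erase hl)) (Finset.ne_of_mem_erase hl).symm
          _ = ((Finset.range I).erase k).card * Q := by rw [Finset.sum_const, nsmul_eq_mul]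
          _ ≤ I * Q := by
              refine mul_le_mul_of_nonneg_right ?_ hQ
              have := Finset.card_erase_le (s := Finset.range I) (a := k)
              rw [Finset.card_range] at this
              exact_mod_cast this
      rw [hdiag]; linarith
    calc ∑ k ∈ Finset.range I, ∑ l ∈ Finset.range I, μ.real (B k ∩ B l) ≤ ∑ _k ∈ Finset.range I, (π' + I * Q) := Finset.sum_le_sum hrow
      _ = I * π' + I * I * Q := by rw [Finset.sum_const, Finset.card_range, nsmul_eq_mul]; ring
  rw [hsum] at hsq
  -- `π'² ≤ π'/I + Q ≤ 1/I + Q`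
  have h1 : π' ^ 2 ≤ π' / I + Q := by
    have h := hsq.trans hdouble
    rw [div_add' _ _ _ hI0.ne', le_div_iff₀ hI0]
    nlinarith
  have hdiv : π' / I ≤ 1 / I := div_le_div_of_nonneg_right hπ1 hI0.le
  have h2 : π' ^ 2 ≤ 1 / I + Q := by linarith
  calc π' = Real.sqrt (π' ^ 2) := (Real.sqrt_sq hπ0).symm
    _ ≤ Real.sqrt (1 / I + Q) := Real.sqrt_le_sqrt h2

end DKT20

end Literature.Probability.Percolation

end
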